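import Literature.Barriers.Parity.SiegelZeroQuadraticPolynomialsTools
import Literature.Barriers.Parity.SiegelZeroQuadraticPolynomialsAbel
import Literature.NumberTheory.LFunctions.ExceptionalZeroPrimeSums
import Literature.NumberTheory.LFunctions.MertensFormula
import HarnessLib

/-!
# Prime-sum bookkeeping for Granville–Mollin's Proposition 2 (`∑ ω(p)/p` over `√q < p ≤ X`)

Topic `Literature/Barriers/Parity`, companion ("Proofs"-type, theorems only, everything PROVED) of
`SiegelZeroQuadraticPolynomials.lean`, third layer of the proof of
`Literature.Barriers.Parity.GranvilleMollin2000_prop2` (Granville–Mollin, *Rabinowitsch revisited*,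
Acta Arith. 96 (2000), Proposition 2 and §8) after `…Tools.lean` (`ω_{f_d}(p) = 1 + (p/q)`, the
split of the Bateman–Horn partial products at `√q`) and `…Abel.lean` (partial summation against
`1/(t log t)` of a prime sum with main term `−t^β/β`). With `d = −q`, `q ≡ 3 (mod 4)`:

* `abs_sum_jacobi_div_sub_expIntegralE1_le` — the Abel step applied to `c_p = (p/q) log p`:
  an explicit-formula bound `|θ(t; (·/q)) + t^β/β| ≤ A₁ t/log t + A₂ t^{1−ν}` on `[U, X]` gives
  `∑_{U < p ≤ X} (p/q)/p = E₁(κ log X) − E₁(κ log U) + O(…)`, `κ = 1 − β`;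
* `abs_sum_inv_primes_sub_loglog_le` — `∑_{u < p ≤ x} 1/p = log log x − log log u + O(1/log u)`
  (Mertens' second theorem with rate, `Literature/NumberTheory/LFunctions/MertensFormula.lean`);
* `sum_omega_div_eq_add`, `sum_omega_div_le_two_mul_exceptional`, `sum_omega_div_head_le`,
  `sum_omega_div_sqrt_U_le` — `∑ ω(p)/p = ∑ 1/p + ∑ (p/q)/p`, the `ω`-sum over `(V, U]` is carried
  by the exceptional primes `(p/q) ≠ −1` (so that Tao–Teräväinen's Proposition 3.5,
  `Literature.NumberTheory.LFunctions.SiegelZero.TaoTeravainen2021_prop35`, bounds it), and the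
  first primes `√q < p ≤ V = q^{(1+ε₁)/2}` contribute `≤ 2ε₁ + 108/log q`.

The assembly of Proposition 2 is `SiegelZeroQuadraticPolynomialsProofs.lean`, via the per-level
estimate of `SiegelZeroQuadraticPolynomialsProp2Limit.lean`.

[cite: GranvilleMollin2000, §5C (5.7)–(5.8) and §8]
-/

noncomputable section

open Finset Real

namespace Literature.Barriers.Parity

open Literature.NumberTheory.LFunctions.SiegelZero (jacobiTheta)
open Literature.NumberTheory.LFunctions.Mertens (primeRecipSum abs_primeRecipSum_sub_le)
open Literature.NumberTheory.Sieve (expIntegralE1 polyRootCountMod)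

/-! ### The Jacobi prime sums as sums over integer intervals -/

/-- `∑_{k ≤ t} c_k = θ(t; (·/q))` for the sequence `c_k = (k/q) log k` on primes, `0` elsewhere.
[folklore] -/
theorem sum_Icc_jacobiLog_eq_jacobiTheta (q : ℕ) (t : ℝ) :
    ∑ k ∈ Icc 0 ⌊t⌋₊, (if k.Prime then ((jacobiSym (k : ℤ) q : ℤ) : ℝ) * Real.log (k : ℝ) else 0) =
      jacobiTheta q t := by
  rw [jacobiTheta, Nat.primesLE_eq_filter_Icc_zero, Finset.sum_filter]

/-- `∑_{a < k ≤ b} c_k/(k log k) = ∑_{a < p ≤ b} (p/q)/p` for `c_k = (k/q) log k` on primes.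
[folklore] -/
theorem sum_Ioc_jacobiLog_div (q a b : ℕ) :
    ∑ k ∈ Ioc a b, (if k.Prime then ((jacobiSym (k : ℤ) q : ℤ) : ℝ) * Real.log (k : ℝ) else 0) /
        ((k : ℝ) * Real.log (k : ℝ)) =
      ∑ p ∈ (Nat.primesLE b).filter (fun p => a < p), ((jacobiSym (p : ℤ) q : ℤ) : ℝ) / (p : ℝ) := by
  have hset : (Nat.primesLE b).filter (fun p => a < p) = (Ioc a b).filter Nat.Prime := by
    ext p
    simp only [mem_filter, Nat.mem_primesLE, mem_Ioc]
    tauto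
  rw [hset, Finset.sum_filter]
  refine sum_congr rfl fun k _ => ?_
  by_cases hp : k.Prime
  · have hk2 : (2 : ℝ) ≤ k := by exact_mod_cast hp.two_le
    have hlog : Real.log (k : ℝ) ≠ 0 := (Real.log_pos (by linarith)).ne'
    have hk0 : (k : ℝ) ≠ 0 := by positivity
    rw [if_pos hp, if_pos hp]
    field_simp
  · rw [if_neg hp, if_neg hp, zero_div]

/-- **Partial summation of `∑ (p/q)/p` against the exceptional main term** (the Abel step
`abs_sum_div_mul_log_sub_expIntegralE1_le` applied to `c_k = (k/q) log k`): if
`|θ(t; (·/q)) + t^{1−κ}/(1−κ)| ≤ A₁ t/log t + A₂ t^{1−ν}` on `[U, X]` (`e ≤ U ≤ X`, `0 < κ < 1`,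
`ν > 0`), then `∑_{U < p ≤ X} (p/q)/p = E₁(κ log X) − E₁(κ log U) + O(…)` with the explicit
error of that lemma. [cite: GranvilleMollin2000, §8] -/
theorem abs_sum_jacobi_div_sub_expIntegralE1_le {q : ℕ} {U X κ ν A₁ A₂ : ℝ}
    (hU : Real.exp 1 ≤ U) (hUX : U ≤ X) (hκ0 : 0 < κ) (hκ1 : κ < 1) (hν : 0 < ν)
    (hA₁ : 0 ≤ A₁) (hA₂ : 0 ≤ A₂)
    (hθ : ∀ t ∈ Set.Icc U X, |jacobiTheta q t + t ^ (1 - κ) / (1 - κ)| ≤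
      A₁ * t / Real.log t + A₂ * t ^ (1 - ν)) :
    |∑ p ∈ (Nat.primesLE ⌊X⌋₊).filter (fun p => ⌊U⌋₊ < p), ((jacobiSym (p : ℤ) q : ℤ) : ℝ) / (p : ℝ) -
        (expIntegralE1 (κ * Real.log X) - expIntegralE1 (κ * Real.log U))| ≤
      A₁ / Real.log X ^ 2 + A₂ * X ^ (-ν) / Real.log X +
        (A₁ / Real.log U ^ 2 + A₂ * U ^ (-ν) / Real.log U) +
        (2 * A₁ / Real.log U + 2 * A₂ * U ^ (-ν) / (ν * Real.log U)) := by
  have h := abs_sum_div_mul_log_sub_expIntegralE1_le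
    (c := fun k : ℕ => if k.Prime then ((jacobiSym (k : ℤ) q : ℤ) : ℝ) * Real.log (k : ℝ) else 0)
    hU hUX hκ0 hκ1 hν hA₁ hA₂ (fun t ht => by rw [sum_Icc_jacobiLog_eq_jacobiTheta]; exact hθ t ht)
  rwa [sum_Ioc_jacobiLog_div] at h

/-! ### Mertens' second theorem on an interval -/

/-- `∑_{u < p ≤ x} 1/p = log log x − log log u + O(8/log x + 8/log u)` for `2 ≤ u ≤ x`
(Mertens' second theorem with rate, twice). [folklore] -/
theorem abs_sum_inv_primes_sub_loglog_le {u x : ℝ} (hu : 2 ≤ u) (hux : u ≤ x) :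
    |∑ p ∈ (Nat.primesLE ⌊x⌋₊).filter (fun p => ⌊u⌋₊ < p), (1 : ℝ) / (p : ℝ) -
        (Real.log (Real.log x) - Real.log (Real.log u))| ≤ 8 / Real.log x + 8 / Real.log u := by
  have hsplit := sum_primesLE_filter_lt (Nat.floor_le_floor hux) (fun p : ℕ => (1 : ℝ) / (p : ℝ))
  have hx := abs_primeRecipSum_sub_le (hu.trans hux)
  have hu' := abs_primeRecipSum_sub_le hu
  simp only [primeRecipSum] at hx hu'
  rw [hsplit]
  simp only [one_div] at hx hu' ⊢
  set Px := ∑ p ∈ Nat.primesLE ⌊x⌋₊, (p : ℝ)⁻¹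
  set Pu := ∑ p ∈ Nat.primesLE ⌊u⌋₊, (p : ℝ)⁻¹
  set B := Literature.NumberTheory.LFunctions.Mertens.meisselMertens
  calc |Px - Pu - (Real.log (Real.log x) - Real.log (Real.log u))|
      = |(Px - Real.log (Real.log x) - B) - (Pu - Real.log (Real.log u) - B)| := by ring_nf
    _ ≤ |Px - Real.log (Real.log x) - B| + |Pu - Real.log (Real.log u) - B| := abs_sub _ _
    _ ≤ 8 / Real.log x + 8 / Real.log u := add_le_add hx hu'

/-- `0 ≤ ∑_{a < p ≤ b} 1/p`. [folklore] -/
theorem sum_inv_primes_nonneg (a b : ℕ) :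
    0 ≤ ∑ p ∈ (Nat.primesLE b).filter (fun p => a < p), (1 : ℝ) / (p : ℝ) :=
  sum_nonneg fun p _ => by positivity

/-! ### The `ω`-sums of `f_d` -/

/-- `∑_{a < p ≤ b} ω(p)/p = ∑_{a < p ≤ b} 1/p + ∑_{a < p ≤ b} (p/q)/p` (`ω(p) = 1 + (p/q)`,
`d = −q`, `q ≡ 3 (mod 4)`). [cite: GranvilleMollin2000, §5 (first display)] -/
theorem sum_omega_div_eq_add {d : ℤ} {q : ℕ} (hdq : d = -(q : ℤ)) (hq4 : q % 4 = 3) (a b : ℕ) :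
    ∑ p ∈ (Nat.primesLE b).filter (fun p => a < p), (polyRootCountMod ![rabinowitschPoly d] p : ℝ) / p =
      ∑ p ∈ (Nat.primesLE b).filter (fun p => a < p), (1 : ℝ) / (p : ℝ) +
        ∑ p ∈ (Nat.primesLE b).filter (fun p => a < p), ((jacobiSym (p : ℤ) q : ℤ) : ℝ) / (p : ℝ) := by
  rw [← sum_add_distrib]
  refine sum_congr rfl fun p hp => ?_
  have hprime : p.Prime := Nat.prime_of_mem_primesLE (mem_filter.mp hp).1
  have h := polyRootCountMod_rabinowitschPoly hdq hq4 hprime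
  have h' : (polyRootCountMod ![rabinowitschPoly d] p : ℝ) = 1 + ((jacobiSym (p : ℤ) q : ℤ) : ℝ) := by
    exact_mod_cast h
  rw [h', add_div]

/-- Each term `ω(p)/p` is nonnegative. [folklore] -/
theorem omega_div_nonneg (d : ℤ) (p : ℕ) : 0 ≤ (polyRootCountMod ![rabinowitschPoly d] p : ℝ) / p := by
  positivity

/-- `∑ ω(p)/p ≥ 0` over any set of primes. [folklore] -/
theorem sum_omega_div_nonneg (d : ℤ) (S : Finset ℕ) :
    0 ≤ ∑ p ∈ S, (polyRootCountMod ![rabinowitschPoly d] p : ℝ) / p :=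
  sum_nonneg fun p _ => omega_div_nonneg d p

/-- `∑_{a < p ≤ b} ω(p)/p ≤ 2 ∑_{a < p ≤ b} 1/p` (`ω(p) ≤ 2`). [folklore] -/
theorem sum_omega_div_le_two_mul {d : ℤ} {q : ℕ} (hdq : d = -(q : ℤ)) (hq4 : q % 4 = 3) (a b : ℕ) :
    ∑ p ∈ (Nat.primesLE b).filter (fun p => a < p), (polyRootCountMod ![rabinowitschPoly d] p : ℝ) / p ≤
      2 * ∑ p ∈ (Nat.primesLE b).filter (fun p => a < p), (1 : ℝ) / (p : ℝ) := by
  rw [mul_sum]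
  refine sum_le_sum fun p hp => ?_
  have hprime : p.Prime := Nat.prime_of_mem_primesLE (mem_filter.mp hp).1
  have h2 : (polyRootCountMod ![rabinowitschPoly d] p : ℝ) ≤ 2 := by
    exact_mod_cast polyRootCountMod_rabinowitschPoly_le_two hdq hq4 hprime
  have hp0 : (0 : ℝ) < p := by exact_mod_cast hprime.pos
  rw [mul_one_div]
  exact div_le_div_of_nonneg_right h2 hp0.le

/-- **The exceptional primes carry the `ω`-sum**: `∑_{V < p ≤ b} ω(p)/p ≤ 2 ∑_{V < p ≤ b, (p/q) ≠ −1} 1/p`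
(`ω(p) = 1 + (p/q)` vanishes when `(p/q) = −1` and is `≤ 2` otherwise). [cite: GranvilleMollin2000, §5C (5.7)] -/
theorem sum_omega_div_le_two_mul_exceptional {d : ℤ} {q : ℕ} (hdq : d = -(q : ℤ)) (hq4 : q % 4 = 3)
    {V : ℝ} (hV : 0 ≤ V) (b : ℕ) :
    ∑ p ∈ (Nat.primesLE b).filter (fun p => ⌊V⌋₊ < p), (polyRootCountMod ![rabinowitschPoly d] p : ℝ) / p ≤
      2 * ∑ p ∈ (Nat.primesLE b).filter (fun p : ℕ => V < (p : ℝ) ∧ jacobiSym (p : ℤ) q ≠ -1),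
        (1 : ℝ) / (p : ℝ) := by
  have hfilt : (Nat.primesLE b).filter (fun p : ℕ => V < (p : ℝ) ∧ jacobiSym (p : ℤ) q ≠ -1) =
      ((Nat.primesLE b).filter (fun p => ⌊V⌋₊ < p)).filter (fun p : ℕ => jacobiSym (p : ℤ) q ≠ -1) := by
    rw [filter_filter]
    refine filter_congr fun p _ => ?_
    rw [Nat.floor_lt hV]
  rw [hfilt, ← sum_filter_add_sum_filter_not ((Nat.primesLE b).filter (fun p => ⌊V⌋₊ < p))
    (fun p : ℕ => jacobiSym (p : ℤ) q ≠ -1)]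
  have hzero : ∑ p ∈ ((Nat.primesLE b).filter (fun p => ⌊V⌋₊ < p)).filter
      (fun p : ℕ => ¬ jacobiSym (p : ℤ) q ≠ -1), (polyRootCountMod ![rabinowitschPoly d] p : ℝ) / p = 0 := by
    refine sum_eq_zero fun p hp => ?_
    rw [mem_filter, not_not] at hp
    have hprime : p.Prime := Nat.prime_of_mem_primesLE (mem_filter.mp hp.1).1
    have hω := polyRootCountMod_rabinowitschPoly hdq hq4 hprime
    rw [hp.2] at hω
    have h0 : polyRootCountMod ![rabinowitschPoly d] p = 0 := by omega
    rw [h0, Nat.cast_zero, zero_div]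
  rw [hzero, add_zero, mul_sum]
  refine sum_le_sum fun p hp => ?_
  have hprime : p.Prime := Nat.prime_of_mem_primesLE (mem_filter.mp (mem_filter.mp hp).1).1
  have hp0 : (0 : ℝ) < p := by exact_mod_cast hprime.pos
  have h2 : (polyRootCountMod ![rabinowitschPoly d] p : ℝ) ≤ 2 := by
    exact_mod_cast polyRootCountMod_rabinowitschPoly_le_two hdq hq4 hprime
  rw [mul_one_div]
  exact div_le_div_of_nonneg_right h2 hp0.le

/-- **The first primes above `√q`**: for natural `s ≥ 2` and real `V ≥ s`,
`∑_{s < p ≤ V} ω(p)/p ≤ 2 (log log V − log log s) + 16/log V + 16/log s` (`ω ≤ 2` and Mertens'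
second theorem with rate). [folklore] -/
theorem sum_omega_div_head_le {d : ℤ} {q : ℕ} (hdq : d = -(q : ℤ)) (hq4 : q % 4 = 3)
    {s : ℕ} {V : ℝ} (hs : 2 ≤ s) (hsV : (s : ℝ) ≤ V) :
    ∑ p ∈ (Nat.primesLE ⌊V⌋₊).filter (fun p => s < p), (polyRootCountMod ![rabinowitschPoly d] p : ℝ) / p ≤
      2 * (Real.log (Real.log V) - Real.log (Real.log s)) + 16 / Real.log V + 16 / Real.log s := by
  have hs2 : (2 : ℝ) ≤ s := by exact_mod_cast hs
  have h1 := sum_omega_div_le_two_mul hdq hq4 s ⌊V⌋₊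
  have h3 : ∑ p ∈ (Nat.primesLE ⌊V⌋₊).filter (fun p => s < p), (1 : ℝ) / (p : ℝ) -
      (Real.log (Real.log V) - Real.log (Real.log s)) ≤ 8 / Real.log V + 8 / Real.log s := by
    have h2 := (abs_le.mp (abs_sum_inv_primes_sub_loglog_le hs2 hsV)).2
    simpa only [Nat.floor_natCast] using h2
  have h4 : ∑ p ∈ (Nat.primesLE ⌊V⌋₊).filter (fun p => s < p), (1 : ℝ) / (p : ℝ) ≤
      (Real.log (Real.log V) - Real.log (Real.log s)) + 8 / Real.log V + 8 / Real.log s := by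
    linarith
  calc ∑ p ∈ (Nat.primesLE ⌊V⌋₊).filter (fun p => s < p), (polyRootCountMod ![rabinowitschPoly d] p : ℝ) / p
      ≤ 2 * ∑ p ∈ (Nat.primesLE ⌊V⌋₊).filter (fun p => s < p), (1 : ℝ) / (p : ℝ) := h1
    _ ≤ 2 * ((Real.log (Real.log V) - Real.log (Real.log s)) + 8 / Real.log V + 8 / Real.log s) :=
        mul_le_mul_of_nonneg_left h4 (by norm_num)
    _ = _ := by ring


/-! ### The head of the `ω`-sum: `√q < p ≤ U` -/

/-- **The first primes above `√q` and the exceptional primes up to `U`** (the bound for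
`∑_{√q < p ≤ U} ω(p)/p` used in Proposition 2): with `V = q^{(1+ε₁)/2} ≤ U` (`0 ≤ ε₁ ≤ 1`,
`log q ≥ 3`) and the Tao–Teräväinen bound `∑_{V < p* ≤ U} 1/p* ≤ T`,
`∑_{⌊√q⌋ < p ≤ U} ω(p)/p ≤ 2ε₁ + 108/log q + 2T`. [cite: GranvilleMollin2000, §5C (5.7)–(5.8)] -/
theorem sum_omega_div_sqrt_U_le {d : ℤ} {q : ℕ} (hdq : d = -(q : ℤ)) (hq4 : q % 4 = 3)
    (hL : 3 ≤ Real.log q) {ε₁ V U T : ℝ} (hε₁0 : 0 ≤ ε₁) (hε₁1 : ε₁ ≤ 1)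
    (hV : V = (q : ℝ) ^ ((1 + ε₁) / 2)) (hVU : V ≤ U)
    (h35 : ∑ p ∈ (Nat.primesLE ⌊U⌋₊).filter
        (fun p : ℕ => V < (p : ℝ) ∧ jacobiSym (p : ℤ) q ≠ -1), (1 : ℝ) / (p : ℝ) ≤ T) :
    ∑ p ∈ (Nat.primesLE ⌊U⌋₊).filter (fun p => ⌊Real.sqrt q⌋₊ < p),
        (polyRootCountMod ![rabinowitschPoly d] p : ℝ) / p ≤
      2 * ε₁ + 108 / Real.log q + 2 * T := by
  -- sizes
  set L := Real.log q with hL_def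
  set s : ℕ := ⌊Real.sqrt q⌋₊ with hs_def
  have hq1 : (1 : ℝ) < q := by
    by_contra h
    push Not at h
    have : Real.log q ≤ 0 := Real.log_nonpos (by positivity) h
    linarith
  have hq0 : (0 : ℝ) < q := by linarith
  have hlog2 : Real.log 2 < 0.7 := lt_trans Real.log_two_lt_d9 (by norm_num)
  have hq16 : (16 : ℝ) ≤ q := by
    -- `log 16 = 4 log 2 < 3 ≤ log q`
    by_contra h
    push Not at h
    have h1 : Real.log q ≤ Real.log 16 := Real.log_le_log hq0 h.le
    have h2 : Real.log 16 = 4 * Real.log 2 := by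
      rw [show (16 : ℝ) = 2 ^ 4 by norm_num, Real.log_pow]; norm_num
    linarith
  have hsqrt4 : (4 : ℝ) ≤ Real.sqrt q := by
    rw [show (4 : ℝ) = Real.sqrt 16 by
      rw [show (16 : ℝ) = 4 ^ 2 by norm_num, Real.sqrt_sq (by norm_num)]]
    exact Real.sqrt_le_sqrt hq16
  have hs_le : (s : ℝ) ≤ Real.sqrt q := Nat.floor_le (Real.sqrt_nonneg _)
  have hs_gt : Real.sqrt q - 1 < s := by
    have := Nat.lt_floor_add_one (Real.sqrt (q : ℝ))
    rw [← hs_def] at this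
    linarith
  have hs_ge : Real.sqrt q / 2 ≤ s := by linarith
  have hs3 : (3 : ℝ) ≤ s := by linarith
  have hs_pos : (0 : ℝ) < s := by linarith
  have hs2 : 2 ≤ s := by exact_mod_cast (show (2 : ℝ) ≤ s by linarith)
  have hlogsqrt : Real.log (Real.sqrt q) = L / 2 := by
    rw [hL_def, Real.log_sqrt hq0.le]
  have hlogs_ge : L / 2 - Real.log 2 ≤ Real.log s := by
    have h : Real.log (Real.sqrt q / 2) ≤ Real.log s := Real.log_le_log (by positivity) hs_ge
    rwa [Real.log_div (by positivity) (by norm_num), hlogsqrt] at h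
  have hlogs_le : Real.log s ≤ L / 2 := by
    rw [← hlogsqrt]; exact Real.log_le_log hs_pos hs_le
  have hlogs4 : L / 4 ≤ Real.log s := by linarith
  have hlogs_pos : 0 < Real.log s := by linarith
  have hlogV : Real.log V = (1 + ε₁) / 2 * L := by rw [hV, Real.log_rpow hq0]
  have hlogV_ge : L / 2 ≤ Real.log V := by rw [hlogV]; nlinarith
  have hlogV_pos : 0 < Real.log V := by linarith
  have hV0 : 0 < V := by rw [hV]; positivity
  have hsV : (s : ℝ) ≤ V := by
    refine hs_le.trans ?_
    rw [Real.sqrt_eq_rpow, hV]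
    exact Real.rpow_le_rpow_of_exponent_le hq1.le (by linarith)
  -- split at `⌊V⌋`
  have hsV' : s ≤ ⌊V⌋₊ := by
    have := Nat.floor_le_floor hsV
    rwa [Nat.floor_natCast] at this
  have hVU' : ⌊V⌋₊ ≤ ⌊U⌋₊ := Nat.floor_le_floor hVU
  rw [sum_primesLE_filter_lt_split hsV' hVU']
  have hH₁ := sum_omega_div_head_le hdq hq4 hs2 hsV
  have hH₂ := sum_omega_div_le_two_mul_exceptional hdq hq4 hV0.le ⌊U⌋₊
  -- the numerical bound for the head
  have hll : Real.log (Real.log V) - Real.log (Real.log s) ≤ ε₁ + 5.6 / L := by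
    have h1 : Real.log (Real.log V) - Real.log (Real.log s) = Real.log (Real.log V / Real.log s) := by
      rw [Real.log_div hlogV_pos.ne' hlogs_pos.ne']
    rw [h1]
    refine (Real.log_le_sub_one_of_pos (div_pos hlogV_pos hlogs_pos)).trans ?_
    rw [div_sub_one hlogs_pos.ne', div_le_iff₀ hlogs_pos]
    have hL0 : 0 < L := by linarith
    have h2 : ε₁ * (L / 2 - Real.log 2) ≤ ε₁ * Real.log s := mul_le_mul_of_nonneg_left hlogs_ge hε₁0
    have h3 : 5.6 / L * (L / 4) ≤ 5.6 / L * Real.log s :=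
      mul_le_mul_of_nonneg_left hlogs4 (by positivity)
    have h4 : 5.6 / L * (L / 4) = 1.4 := by field_simp; ring
    rw [hlogV]
    nlinarith
  have hL0 : 0 < L := by linarith
  have h16V : 16 / Real.log V ≤ 32 / L := by
    rw [div_le_div_iff₀ hlogV_pos hL0]; nlinarith
  have h16s : 16 / Real.log s ≤ 64 / L := by
    rw [div_le_div_iff₀ hlogs_pos hL0]; nlinarith
  have h56 : 2 * (5.6 / L) + 32 / L + 64 / L ≤ 108 / L := by
    rw [show 2 * (5.6 / L) + 32 / L + 64 / L = 107.2 / L by ring]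
    exact div_le_div_of_nonneg_right (by norm_num) hL0.le
  linarith


end Literature.Barriers.Parity
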